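import Literature.Computability.QuantumComplexity.ShallowCircuitsRectangle
import Literature.Computability.QuantumComplexity.ShallowCircuitsEncodeProofs
import HarnessLib

/-!
# 2D HLF restricted to an embedded cycle: the ring graph-state relation

Bravyi–Gosset–König's classical lower bound for the 2D Hidden Linear Function problem restricts
the problem to instances `(A, b)` with `A` the adjacency matrix of an even cycle `Γ` embedded in
the grid and `b` supported on `Γ` (arXiv:1704.00690 §4.1–4.2, Eq. (31); tree:
`Necklace.hlfInstance`, where `b` lives on three hubs). This file treats an ARBITRARY linear part
`b = x` on the cycle — the sub-family "measure every qubit of the `n`-cycle graph state in the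
`X` (`x_i = 0`) or `Y` (`x_i = 1`) basis" of Barrett–Caves–Eastin–Elliott–Pironio 2007 §IV.A and
BGK §4.1 — and identifies the HLF solution set with a purely combinatorial RING RELATION:

* `RingHLF.InKernel x v` — `v ∈ K(x) := ker (A_{C_n} + diag x)` over `𝔽₂`:
  `v_{i-1} + v_{i+1} + x_i v_i = 0` for all `i` (indices mod `n`);
* `RingHLF.signBit x v = (#{ring edges inside supp v} + |x ∧ v|/2) mod 2`;
* `RingHLF.Rel x z` — `⟨v, z⟩ ≡ signBit x v (mod 2)` for every `v ∈ K(x)`;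
* `GridCycle N n` — an injective map `Fin n → Fin N × Fin N` sending cyclically consecutive
  positions to grid neighbours; `GridCycle.ringInstance γ x : HLFInstance N` — `A` = the cycle's
  adjacency matrix, `b = x` on the cycle, `0` elsewhere; it is valid (`ringInstance_isValid`);
* `GridCycle.mem_Lq_iff` — `z ∈ L_q` iff `z|_γ ∈ K(x)` (`n ≥ 3`; tree `HLFInstance.mem_Lq_iff`);
* `GridCycle.rel_of_mem_hlfSolutions` — every HLF solution `z` of `ringInstance γ x` restricts
  on the cycle to a solution of the ring relation: `RingHLF.Rel x (z ∘ γ)` (`n ≥ 3`; tree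
  `HLFInstance.solution_identity`, the computation of BGK's proof of Claim 3 / tree
  `Necklace.solution_congr` with a general linear part);
* `RectData.gridCycle R : GridCycle N (2·m)` — the boundary of a rectangle (tree `RectData`) is
  such a cycle, so every grid of size `N > 2t`, `t ≥ 2`, carries a cycle of length `8t`
  (`GridCycle.square`).

So an `N × N` 2D-HLF solver, run on `ringInstance γ x`, solves the ring relation for `x` on its
cycle outputs; this is the reduction used by the advice-free `QNC⁰` versus `AC⁰[p]` programme
(cell qa-qnc0), whose candidate hard problem is `RingHLF.Rel`.

Deliberately NOT here: the converse (`z = 0` off `γ` and `Rel x (z ∘ γ)` imply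
`z ∈ hlfSolutions`), the structure of `K(x)` (transfer matrices / `S₃` monodromy).

## References

* S. Bravyi, D. Gosset, R. König, *Quantum advantage with shallow circuits*, Science 362 (2018)
  308–311, arXiv:1704.00690, §4.1–4.2 (cycle instances, Eq. (31)), §3 Lemma 1–2
  [BravyiGossetKonigScience2018].
* J. Barrett, C. M. Caves, B. Eastin, M. B. Elliott, S. Pironio, *Modeling Pauli measurements on
  graph states with nearest-neighbor classical communication*, Phys. Rev. A 75 (2007) 012103,
  arXiv:quant-ph/0603032, §IV.A (the `n`-ring) [BarrettEtAl2007].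
-/

namespace Literature.Computability.QuantumComplexity

open Finset SimpleGraph

/-! ### The abstract ring relation on `Fin n` -/

namespace RingHLF

variable {n : ℕ}

/-- Cyclic successor on `Fin n`. [folklore] -/
def nxt (b : Fin n) : Fin n := ⟨(b.val + 1) % n, Nat.mod_lt _ b.pos⟩

/-- Cyclic predecessor on `Fin n`. [folklore] -/
def prv (b : Fin n) : Fin n := ⟨(b.val + n - 1) % n, Nat.mod_lt _ b.pos⟩

/-- `nxt (prv b) = b` (positions of the ring `Cₙ`, indices mod `n`). [cite: BarrettEtAl2007, §IV.A] -/
@[simp] theorem nxt_prv (b : Fin n) : nxt (prv b) = b := by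
  have hb := b.isLt
  ext
  simp only [nxt, prv]
  rcases Nat.eq_zero_or_pos b.val with h0 | hpos
  · rw [h0, Nat.zero_add, Nat.mod_eq_of_lt (show n - 1 < n by omega),
      show n - 1 + 1 = n by omega, Nat.mod_self]
  · rw [show b.val + n - 1 = (b.val - 1) + n by omega, Nat.add_mod_right,
      Nat.mod_eq_of_lt (show b.val - 1 < n by omega), show b.val - 1 + 1 = b.val by omega,
      Nat.mod_eq_of_lt hb]

/-- `prv (nxt b) = b` (positions of the ring `Cₙ`, indices mod `n`). [cite: BarrettEtAl2007, §IV.A] -/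
@[simp] theorem prv_nxt (b : Fin n) : prv (nxt b) = b := by
  have hb := b.isLt
  ext
  simp only [nxt, prv]
  by_cases h : b.val + 1 < n
  · rw [Nat.mod_eq_of_lt h, show b.val + 1 + n - 1 = b.val + n by omega, Nat.add_mod_right,
      Nat.mod_eq_of_lt hb]
  · have he : b.val + 1 = n := by omega
    rw [he, Nat.mod_self, Nat.zero_add, Nat.mod_eq_of_lt (show n - 1 < n by omega)]
    omega

/-- `nxt` is injective (indices mod `n` on the ring `Cₙ`). [cite: BarrettEtAl2007, §IV.A] -/
theorem nxt_injective : Function.Injective (nxt (n := n)) := fun a b h => by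
  rw [← prv_nxt a, ← prv_nxt b, h]

/-- `prv` is injective (indices mod `n` on the ring `Cₙ`). [cite: BarrettEtAl2007, §IV.A] -/
theorem prv_injective : Function.Injective (prv (n := n)) := fun a b h => by
  rw [← nxt_prv a, ← nxt_prv b, h]

/-- On a ring of length `≥ 3` the two neighbours of a position are distinct. [cite: BarrettEtAl2007, §IV.A] -/
theorem prv_ne_nxt (hn : 3 ≤ n) (b : Fin n) : prv b ≠ nxt b := by
  intro h
  have hv := congrArg Fin.val h
  simp only [nxt, prv] at hv
  have hb := b.isLt
  rcases Nat.eq_zero_or_pos b.val with h0 | hpos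
  · rw [h0, Nat.zero_add, Nat.zero_add, Nat.mod_eq_of_lt (show n - 1 < n by omega),
      Nat.mod_eq_of_lt (show 1 < n by omega)] at hv
    omega
  · rw [show b.val + n - 1 = (b.val - 1) + n by omega, Nat.add_mod_right,
      Nat.mod_eq_of_lt (show b.val - 1 < n by omega)] at hv
    by_cases hc : b.val + 1 < n
    · rw [Nat.mod_eq_of_lt hc] at hv; omega
    · rw [show b.val + 1 = n by omega, Nat.mod_self] at hv; omega

/-- The ring kernel `K(x) = ker (A_{Cₙ} + diag x)` over `𝔽₂`: `v ∈ K(x)` iff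
`v_{i-1} + v_{i+1} + x_i v_i = 0` for every position `i` (the products of graph-state
stabilisers `∏_{i ∈ supp v} K_i` that commute with the measured `X`/`Y` observables).
(Barrett et al. 2007, §IV.A; Bravyi–Gosset–König 2018, §4.1.)
[cite: BravyiGossetKonigScience2018, §4.1] -/
def InKernel (x v : Fin n → Bool) : Prop :=
  ∀ b : Fin n, (xor (xor (v (prv b)) (v (nxt b))) (x b && v b)) = false

/-- `InKernel` is decidable. [folklore] -/
instance (x v : Fin n → Bool) : Decidable (InKernel x v) := by
  unfold InKernel; infer_instance

/-- The number of ring edges `{i, i+1}` inside the support of `v`. [folklore] -/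
def edgesIn (v : Fin n → Bool) : ℕ :=
  (univ.filter fun b : Fin n => v b = true ∧ v (nxt b) = true).card

/-- `|x ∧ v|`, the number of positions where both `x` and `v` are `1`. [folklore] -/
def wtAnd (x v : Fin n → Bool) : ℕ := (univ.filter fun b : Fin n => x b = true ∧ v b = true).card

/-- The sign bit `ℓ_x(v) = (#edges inside supp v + |x ∧ v|/2) mod 2` — the value `q(v)/2` of
the HLF quadratic form on a kernel vector. (Bravyi–Gosset–König 2018, Eq. (1)–(2).)
[cite: BravyiGossetKonigScience2018, Eq. (2)] -/
def signBit (x v : Fin n → Bool) : ℕ := (edgesIn v + wtAnd x v / 2) % 2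

/-- `⟨v, z⟩ mod 2`. [folklore] -/
def dot2 (v z : Fin n → Bool) : ℕ := (univ.filter fun b : Fin n => v b = true ∧ z b = true).card % 2

/-- **The ring relation** `Rel(Cₙ)`: `z` is a valid output for the measurement pattern `x` iff
`⟨v, z⟩ ≡ ℓ_x(v) (mod 2)` for every `v ∈ K(x)` — the possible outcome strings of measuring the
`n`-cycle graph state in the bases `X` (`x_i = 0`) / `Y` (`x_i = 1`), equivalently
(`GridCycle.rel_of_mem_hlfSolutions`) the restrictions to the cycle of the 2D-HLF solutions of
the cycle instance. (Bravyi–Gosset–König 2018, §4.1; Barrett et al. 2007, §IV.A.)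
[cite: BravyiGossetKonigScience2018, §4.1] -/
def Rel (x z : Fin n → Bool) : Prop := ∀ v : Fin n → Bool, InKernel x v → dot2 v z = signBit x v

/-- `Rel` is decidable. [folklore] -/
instance (x z : Fin n → Bool) : Decidable (Rel x z) := by
  unfold Rel; infer_instance

end RingHLF

/-! ### Cycles embedded in the grid and their HLF instances -/

/-- A cycle of length `n` embedded in the `N × N` grid: an injective map of the positions
`Fin n` to grid vertices such that cyclically consecutive positions are grid neighbours.
(Bravyi–Gosset–König 2018, §4.1: the cycle `Γ`.) [cite: BravyiGossetKonigScience2018, §4.1] -/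
structure GridCycle (N n : ℕ) where
  /-- The embedding of the positions. -/
  toFun : Fin n → Fin N × Fin N
  /-- The embedding is injective. -/
  injective : Function.Injective toFun
  /-- Consecutive positions are grid neighbours. -/
  adj : ∀ i, (gridGraph N).Adj (toFun i) (toFun (RingHLF.nxt i))

namespace GridCycle

open RingHLF

variable {N n : ℕ} (γ : GridCycle N n)

/-- Transport along an equality of lengths. [folklore] -/
def cast {n' : ℕ} (h : n = n') (γ : GridCycle N n) : GridCycle N n' where
  toFun i := γ.toFun (Fin.cast h.symm i)
  injective := fun i j hij => by
    have := γ.injective hij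
    rwa [Fin.cast_inj] at this
  adj i := by
    have h1 := γ.adj (Fin.cast h.symm i)
    have h2 : nxt (Fin.cast h.symm i) = Fin.cast h.symm (nxt i) := by
      ext; simp [nxt, h]
    rwa [h2] at h1

/-- **The cycle instance** of 2D HLF with measurement pattern `x ∈ {0,1}ⁿ`: `A` is the adjacency
matrix of the embedded cycle, `b = x` on the cycle and `0` off it. (Bravyi–Gosset–König 2018,
§4.2 Eq. (31), with a general linear part on the cycle.)
[cite: BravyiGossetKonigScience2018, §4.2 Eq. (31)] -/
def ringInstance (x : Fin n → Bool) : HLFInstance N where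
  A a a' := decide (∃ i, (γ.toFun i = a ∧ γ.toFun (nxt i) = a') ∨ (γ.toFun i = a' ∧ γ.toFun (nxt i) = a))
  b a := decide (∃ i, γ.toFun i = a ∧ x i = true)

/-- The indicator vector on the grid of a set of cycle positions. [folklore] -/
def ind (v : Fin n → Bool) : Fin N × Fin N → Bool :=
  fun a => decide (∃ i, γ.toFun i = a ∧ v i = true)

variable {γ}

/-- The cycle matrix at two embedded positions: adjacency on the abstract ring (BGK's `A` = the
adjacency matrix of `Γ`). [cite: BravyiGossetKonigScience2018, §4.2 Eq. (31)] -/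
theorem ringInstance_A_apply (x : Fin n → Bool) (i j : Fin n) :
    (γ.ringInstance x).A (γ.toFun i) (γ.toFun j) = true ↔ (j = nxt i ∨ i = nxt j) := by
  simp only [ringInstance, decide_eq_true_eq]
  constructor
  · rintro ⟨k, ⟨h1, h2⟩ | ⟨h1, h2⟩⟩
    · left; rw [← γ.injective h1, ← γ.injective h2]
    · right; rw [← γ.injective h1, ← γ.injective h2]
  · rintro (h | h)
    · exact ⟨i, Or.inl ⟨rfl, by rw [h]⟩⟩
    · exact ⟨j, Or.inr ⟨rfl, by rw [h]⟩⟩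

/-- Entries of the cycle matrix are supported on embedded positions. [cite: BravyiGossetKonigScience2018, §4.2 Eq. (31)] -/
theorem ringInstance_A_eq_true {x : Fin n → Bool} {a a' : Fin N × Fin N}
    (h : (γ.ringInstance x).A a a' = true) : (∃ i, γ.toFun i = a) ∧ ∃ j, γ.toFun j = a' := by
  simp only [ringInstance, decide_eq_true_eq] at h
  obtain ⟨i, ⟨h1, h2⟩ | ⟨h1, h2⟩⟩ := h
  · exact ⟨⟨i, h1⟩, ⟨nxt i, h2⟩⟩
  · exact ⟨⟨nxt i, h2⟩, ⟨i, h1⟩⟩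

/-- The linear part at an embedded position is the pattern bit. [cite: BravyiGossetKonigScience2018, §4.2 Eq. (31)] -/
theorem ringInstance_b_apply (x : Fin n → Bool) (i : Fin n) :
    (γ.ringInstance x).b (γ.toFun i) = true ↔ x i = true := by
  simp only [ringInstance, decide_eq_true_eq]
  constructor
  · rintro ⟨k, hk, hx⟩; rwa [← γ.injective hk]
  · intro h; exact ⟨i, rfl, h⟩

/-- The linear part is supported on the cycle. [cite: BravyiGossetKonigScience2018, §4.2 Eq. (31)] -/
theorem ringInstance_b_eq_true {x : Fin n → Bool} {a : Fin N × Fin N}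
    (h : (γ.ringInstance x).b a = true) : ∃ i, γ.toFun i = a := by
  simp only [ringInstance, decide_eq_true_eq] at h
  obtain ⟨i, hi, -⟩ := h
  exact ⟨i, hi⟩

/-- **Cycle instances are valid 2D-HLF instances**: `A` is symmetric and supported on grid
edges. [cite: BravyiGossetKonigScience2018, §4.2 Eq. (31)] -/
theorem ringInstance_isValid (x : Fin n → Bool) : (γ.ringInstance x).IsValid := by
  constructor
  · intro a a'
    simp only [ringInstance]
    rw [decide_eq_decide]
    constructor <;> rintro ⟨i, h | h⟩
    · exact ⟨i, Or.inr h⟩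
    · exact ⟨i, Or.inl h⟩
    · exact ⟨i, Or.inr h⟩
    · exact ⟨i, Or.inl h⟩
  · intro a a' h
    simp only [ringInstance, decide_eq_true_eq] at h
    obtain ⟨i, ⟨rfl, rfl⟩ | ⟨rfl, rfl⟩⟩ := h
    · exact γ.adj i
    · exact (γ.adj i).symm

/-- The indicator `1_v` at an embedded position (BGK: the vectors `1_S` supported on `Γ`). [cite: BravyiGossetKonigScience2018, §4.2 Eq. (31)] -/
theorem ind_apply (v : Fin n → Bool) (i : Fin n) : γ.ind v (γ.toFun i) = v i := by
  unfold ind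
  rw [Bool.eq_iff_iff, decide_eq_true_eq]
  constructor
  · rintro ⟨k, hk, hv⟩; rwa [← γ.injective hk]
  · intro h; exact ⟨i, rfl, h⟩

/-- The indicator `1_v` is supported on the cycle. [cite: BravyiGossetKonigScience2018, §4.2 Eq. (31)] -/
theorem ind_eq_true {v : Fin n → Bool} {a : Fin N × Fin N} (h : γ.ind v a = true) :
    ∃ i, γ.toFun i = a := by
  unfold ind at h
  rw [decide_eq_true_eq] at h
  obtain ⟨i, hi, -⟩ := h
  exact ⟨i, hi⟩

/-- Transport of sums: a function on the grid vanishing off the cycle is summed over the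
positions (as for the tree's `Necklace.sum_eq_sum_toFun`). [cite: BravyiGossetKonigScience2018, §4.2 Eq. (31)] -/
theorem sum_eq_sum_toFun {M : Type*} [AddCommMonoid M] (γ : GridCycle N n)
    (f : Fin N × Fin N → M) (hf : ∀ a, (∀ i, γ.toFun i ≠ a) → f a = 0) :
    ∑ a, f a = ∑ i, f (γ.toFun i) := by
  classical
  calc ∑ a, f a = ∑ a ∈ univ.image γ.toFun, f a := by
        symm
        apply Finset.sum_subset (Finset.subset_univ _)
        intro a _ ha
        apply hf
        intro i hi
        exact ha (hi ▸ mem_image_of_mem _ (mem_univ i))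
    _ = ∑ i, f (γ.toFun i) := Finset.sum_image fun p _ q _ h => γ.injective h

/-- **The kernel count on the cycle** (`n ≥ 3`): for any grid vector `z`,
`((A + diag b) z)_{γ i} = [z_{γ(i-1)}] + [z_{γ(i+1)}] + [x_i ∧ z_{γ i}]` (the row of
`A + diag b` at a cycle vertex). [cite: BravyiGossetKonigScience2018, §4.2 Eq. (31)] -/
theorem kerCount_toFun (hn : 3 ≤ n) (x : Fin n → Bool) (z : Fin N × Fin N → Bool) (i : Fin n) :
    (γ.ringInstance x).kerCount z (γ.toFun i) =
      (if z (γ.toFun (prv i)) = true then 1 else 0) + (if z (γ.toFun (nxt i)) = true then 1 else 0) +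
        (if x i = true ∧ z (γ.toFun i) = true then 1 else 0) := by
  unfold HLFInstance.kerCount
  congr 1
  · rw [card_filter, γ.sum_eq_sum_toFun]
    · -- on the positions: only `prv i` and `nxt i` are `A`-neighbours of `γ i`
      have hA : ∀ j, ((γ.ringInstance x).A (γ.toFun j) (γ.toFun i) = true) ↔ (j = prv i ∨ j = nxt i) := by
        intro j
        rw [ringInstance_A_apply]
        constructor
        · rintro (h | h)
          · left; rw [h, prv_nxt]
          · right; exact h
        · rintro (h | h)
          · left; rw [h, nxt_prv]
          · right; exact h
      rw [← Finset.sum_erase_add _ _ (mem_univ (prv i)),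
        ← Finset.sum_erase_add _ _ (Finset.mem_erase.2 ⟨(prv_ne_nxt hn i).symm, mem_univ (nxt i)⟩)]
      rw [Finset.sum_eq_zero]
      · simp only [hA, true_or, or_true, true_and, zero_add]
        rw [add_comm]
      · intro j hj
        rw [Finset.mem_erase, Finset.mem_erase] at hj
        rw [if_neg]
        rintro ⟨h, -⟩
        rcases (hA j).1 h with h' | h'
        · exact hj.2.1 h'
        · exact hj.1 h'
    · intro a ha
      rw [if_neg]
      rintro ⟨h, -⟩
      obtain ⟨⟨j, hj⟩, -⟩ := ringInstance_A_eq_true h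
      exact ha j hj
  · simp only [ringInstance_b_apply]

/-- Off the cycle the kernel count vanishes (`A` and `b` are supported on `Γ`). [cite: BravyiGossetKonigScience2018, §4.2 Eq. (31)] -/
theorem kerCount_eq_zero (x : Fin n → Bool) (z : Fin N × Fin N → Bool) (a : Fin N × Fin N)
    (ha : ∀ i, γ.toFun i ≠ a) : (γ.ringInstance x).kerCount z a = 0 := by
  unfold HLFInstance.kerCount
  rw [Finset.card_eq_zero.mpr, if_neg, add_zero]
  · rintro ⟨h, -⟩
    obtain ⟨i, hi⟩ := ringInstance_b_eq_true h
    exact ha _ hi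
  · rw [Finset.filter_eq_empty_iff]
    rintro u - ⟨h, -⟩
    obtain ⟨-, ⟨j, hj⟩⟩ := ringInstance_A_eq_true h
    exact ha j hj

/-- Parity of a sum of three indicator bits as an `xor`. [folklore] -/
private theorem even_ite_add_iff (a b c : Bool) :
    Even ((if a = true then 1 else 0) + (if b = true then 1 else 0) + (if c = true then 1 else 0) : ℕ) ↔
      (xor (xor a b) c) = false := by
  cases a <;> cases b <;> cases c <;> decide

/-- **`L_q` of a cycle instance is the ring kernel** (`n ≥ 3`): a grid vector `z` lies in
`L_q(ringInstance γ x)` iff its restriction to the cycle lies in `K(x)` (coordinates off the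
cycle are unconstrained). (Tree `HLFInstance.mem_Lq_iff`: `L_q = ker(A + diag b)`; BGK 2018
§4.1.) [cite: BravyiGossetKonigScience2018, §4.1] -/
theorem mem_Lq_iff (hn : 3 ≤ n) (x : Fin n → Bool) (z : Fin N × Fin N → Bool) :
    z ∈ (γ.ringInstance x).Lq ↔ InKernel x (fun i => z (γ.toFun i)) := by
  rw [HLFInstance.mem_Lq_iff _ (ringInstance_isValid x)]
  constructor
  · intro h b
    have hb := h (γ.toFun b)
    rw [kerCount_toFun hn] at hb
    rw [← even_ite_add_iff]
    convert hb using 3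
    by_cases hx : x b = true <;> by_cases hz : z (γ.toFun b) = true <;> simp [hx, hz]
  · intro h a
    by_cases ha : ∃ i, γ.toFun i = a
    · obtain ⟨i, rfl⟩ := ha
      rw [kerCount_toFun hn]
      have hb := h i
      rw [← even_ite_add_iff] at hb
      convert hb using 3
      by_cases hx : x i = true <;> by_cases hz : z (γ.toFun i) = true <;> simp [hx, hz]
    · rw [kerCount_eq_zero x z a (fun i hi => ha ⟨i, hi⟩)]
      exact Even.zero

/-- From the `ℤ₄` identity `2e + w = 2c` to the bit identity `c ≡ e + w/2 (mod 2)`. [folklore] -/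
private theorem mod_two_of_zmod4 {e w c : ℕ} (h : (2 * e + w : ZMod 4) = 2 * c) :
    c % 2 = (e + w / 2) % 2 := by
  have h4 : (2 * e + w) % 4 = (2 * c) % 4 := by
    have := (ZMod.natCast_eq_natCast_iff' (2 * e + w) (2 * c) 4).1 (by push_cast; exact h)
    exact this
  omega

/-- **HLF solutions of a cycle instance solve the ring relation** (`n ≥ 3`): if `z` is a 2D-HLF
solution of `ringInstance γ x` (`q(v) = 2⟨z, v⟩` on `L_q`), then its restriction to the cycle
satisfies `⟨v, z|_γ⟩ ≡ #edges(supp v) + |x ∧ v|/2 (mod 2)` for every `v ∈ K(x)`: evaluate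
`q(1_v) = 2·#edges(supp v) + |x ∧ v| (mod 4)` (tree `HLFInstance.solution_identity`; the
computation of BGK's Claim 3 with a general linear part).
[cite: BravyiGossetKonigScience2018, §4.1] -/
theorem rel_of_mem_hlfSolutions (hn : 3 ≤ n) (x : Fin n → Bool) {z : Fin N × Fin N → Bool}
    (hz : z ∈ hlfSolutions (γ.ringInstance x)) : Rel x (fun i => z (γ.toFun i)) := by
  intro v hv
  -- the lift `1_v` of `v` to the grid lies in the kernel
  have hx : ∀ a, Even ((γ.ringInstance x).kerCount (γ.ind v) a) := by
    rw [← HLFInstance.mem_Lq_iff _ (ringInstance_isValid x), mem_Lq_iff hn]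
    simpa only [ind_apply] using hv
  have key := HLFInstance.solution_identity (γ.ringInstance x) (ringInstance_isValid x) hz hx
  -- evaluate the three counts on the cycle
  have hquad : (∑ a, ∑ a', if (γ.ringInstance x).A a a' = true ∧ γ.ind v a = true ∧
      γ.ind v a' = true then (1 : ZMod 4) else 0) = 2 * (edgesIn v : ZMod 4) := by
    rw [γ.sum_eq_sum_toFun]
    · have hin : ∀ i, (∑ a', if (γ.ringInstance x).A (γ.toFun i) a' = true ∧
          γ.ind v (γ.toFun i) = true ∧ γ.ind v a' = true then (1 : ZMod 4) else 0) =
          (if v i = true ∧ v (nxt i) = true then (1 : ZMod 4) else 0) +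
            (if v i = true ∧ v (prv i) = true then (1 : ZMod 4) else 0) := by
        intro i
        rw [γ.sum_eq_sum_toFun]
        · simp only [ringInstance_A_apply, ind_apply]
          rw [← Finset.sum_erase_add _ _ (mem_univ (nxt i)),
            ← Finset.sum_erase_add _ _ (Finset.mem_erase.2 ⟨prv_ne_nxt hn i, mem_univ (prv i)⟩)]
          rw [Finset.sum_eq_zero, zero_add]
          · have h1 : ¬ (nxt i = nxt i ∨ i = nxt (nxt i)) ↔ False := by simp
            have h2 : (prv i = nxt i ∨ i = nxt (prv i)) := Or.inr (by rw [nxt_prv])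
            simp only [true_or, true_and, h2]
            rw [add_comm]
          · intro j hj
            rw [Finset.mem_erase, Finset.mem_erase] at hj
            rw [if_neg]
            rintro ⟨h, -⟩
            rcases h with h' | h'
            · exact hj.2.1 h'
            · exact hj.1 (by rw [h', prv_nxt])
        · intro a ha
          rw [if_neg]
          rintro ⟨-, -, h⟩
          obtain ⟨j, hj⟩ := ind_eq_true h
          exact ha j hj
      simp_rw [hin]
      rw [Finset.sum_add_distrib, two_mul]
      congr 1
      · unfold edgesIn
        rw [natCast_card_filter]
      · unfold edgesIn
        rw [natCast_card_filter]
        -- reindex `i ↦ prv i`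
        rw [show (∑ i : Fin n, if v i = true ∧ v (prv i) = true then (1 : ZMod 4) else 0) =
            ∑ i : Fin n, (if v (nxt (prv i)) = true ∧ v (prv i) = true then (1 : ZMod 4) else 0) by
          simp only [nxt_prv]]
        rw [show (∑ i : Fin n, if v (nxt (prv i)) = true ∧ v (prv i) = true then (1 : ZMod 4) else 0) =
            ∑ j : Fin n, (if v (nxt j) = true ∧ v j = true then (1 : ZMod 4) else 0) from
          Finset.sum_bij (fun i _ => prv i) (fun _ _ => mem_univ _)
            (fun a _ b _ h => prv_injective h) (fun j _ => ⟨nxt j, mem_univ _, prv_nxt j⟩)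
            (fun _ _ => rfl)]
        refine Finset.sum_congr rfl fun j _ => ?_
        simp only [and_comm]
    · intro a ha
      apply Finset.sum_eq_zero
      intro a' _
      rw [if_neg]
      rintro ⟨-, h, -⟩
      obtain ⟨j, hj⟩ := ind_eq_true h
      exact ha j hj
  have hlin : (∑ a, if (γ.ringInstance x).b a = true ∧ γ.ind v a = true then (1 : ZMod 4) else 0) =
      (wtAnd x v : ZMod 4) := by
    rw [γ.sum_eq_sum_toFun]
    · unfold wtAnd
      rw [natCast_card_filter]
      simp only [ringInstance_b_apply, ind_apply]
    · intro a ha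
      rw [if_neg]
      rintro ⟨h, -⟩
      obtain ⟨j, hj⟩ := ringInstance_b_eq_true h
      exact ha j hj
  have hsol : ((univ.filter fun a => z a = true ∧ γ.ind v a = true).card : ZMod 4) =
      ((univ.filter fun b : Fin n => v b = true ∧ z (γ.toFun b) = true).card : ZMod 4) := by
    rw [natCast_card_filter, natCast_card_filter, γ.sum_eq_sum_toFun]
    · simp only [ind_apply, and_comm]
    · intro a ha
      rw [if_neg]
      rintro ⟨-, h⟩
      obtain ⟨j, hj⟩ := ind_eq_true h
      exact ha j hj
  rw [hquad, hlin, hsol] at key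
  -- conclude
  unfold dot2 signBit
  exact mod_two_of_zmod4 key

/-- **The input string of a cycle instance is a projection of the pattern.** Every coordinate of
`encodeHLF (ringInstance γ x)` is either a constant (the `A`-blocks: the fixed cycle; `b` off the
cycle: `0`) or one of the pattern bits `x_i` (`b` at the `i`-th cycle vertex) — so hard-wiring an
`N × N` HLF circuit to cycle instances is a substitution of variables and constants
(BGK's input layout, §3 Eq. (14); tree `encodeHLF_castAdd_castAdd`, `encodeHLF_natAdd`).
[cite: BravyiGossetKonigScience2018, §3 Eq. (14)] -/
theorem encodeHLF_ringInstance_subst (γ : GridCycle N n) (c : Fin (inLen N)) :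
    (∃ b, ∀ x : Fin n → Bool, encodeHLF (γ.ringInstance x) c = b) ∨
      (∃ i, ∀ x : Fin n → Bool, encodeHLF (γ.ringInstance x) c = x i) := by
  induction c using Fin.addCases with
  | left c =>
    -- the `A`-blocks do not depend on the pattern
    left
    refine ⟨encodeHLF (γ.ringInstance fun _ => false) (Fin.castAdd (N * N) c), fun x => ?_⟩
    induction c using Fin.addCases with
    | left k => simp only [encodeHLF_castAdd_castAdd, ringInstance]
    | right k => simp only [encodeHLF_castAdd_natAdd, ringInstance]
  | right k =>
    by_cases h : ∃ i, γ.toFun i = finProdFinEquiv.symm k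
    · obtain ⟨i, hi⟩ := h
      right
      refine ⟨i, fun x => ?_⟩
      rw [encodeHLF_natAdd, ← hi]
      rw [Bool.eq_iff_iff, ringInstance_b_apply]
    · left
      refine ⟨false, fun x => ?_⟩
      rw [encodeHLF_natAdd, Bool.eq_false_iff]
      intro hb
      exact h (ringInstance_b_eq_true hb)

end GridCycle

/-! ### Cycles of every length `8t` in large grids: rectangle boundaries -/

namespace RectData

open RingHLF

variable {N : ℕ} (R : RectData N)

/-- **The boundary of a rectangle is a grid cycle** of length `2m = 4(hw + hh)` (tree
`RectData.posRow/posCol`, `natAdj_succ`, `natAdj_last`, `inv_pos`).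
[cite: BravyiGossetKonigScience2018, §4.2] -/
def gridCycle : GridCycle N (2 * R.m) where
  toFun k := (⟨R.posRow k, R.posRow_lt _⟩, ⟨R.posCol k, R.posCol_lt _⟩)
  injective := by
    intro k k' h
    have h1 : R.posRow k = R.posRow k' := congrArg (fun a => a.1.val) h
    have h2 : R.posCol k = R.posCol k' := congrArg (fun a => a.2.val) h
    apply Fin.ext
    rw [← R.inv_pos k.isLt, ← R.inv_pos k'.isLt, h1, h2]
  adj k := by
    apply gridGraph_adj_of_natAdj
    simp only [nxt]
    by_cases hk : k.val + 1 < 2 * R.m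
    · rw [Nat.mod_eq_of_lt hk]
      exact R.natAdj_succ hk
    · have hk' : k.val = 2 * R.m - 1 := by have := k.isLt; omega
      rw [show k.val + 1 = 2 * R.m by omega, Nat.mod_self, hk']
      exact R.natAdj_last

/-- The square of half-side `t ≥ 2` with top-left corner `(0,0)` in a grid of size `N > 2t`
(hubs at half-offsets `1`, irrelevant here). [folklore] -/
def square (t : ℕ) (ht : 2 ≤ t) (hN : 2 * t < N) : RectData N where
  r₁ := 0
  c₁ := 0
  hw := t
  hh := t
  a := 1
  b := 1
  c := 1
  a_pos := Nat.one_pos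
  a_lt := ht
  b_pos := Nat.one_pos
  b_lt := ht
  c_pos := Nat.one_pos
  c_lt := ht
  row_lt := by omega
  col_lt := by omega

/-- The square of half-side `t` has half-perimeter `m = 4t`. [cite: BravyiGossetKonigScience2018, §4.2] -/
theorem square_m (t : ℕ) (ht : 2 ≤ t) (hN : 2 * t < N) : (square t ht hN).m = 4 * t := by
  unfold m square; ring

end RectData

namespace GridCycle

/-- **Every large grid carries long cycles**: for `t ≥ 2` and `N > 2t` there is a grid cycle of
length `8t` in the `N × N` grid (the boundary of a `2t × 2t` square).
[cite: BravyiGossetKonigScience2018, §4.2] -/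
def square {N : ℕ} (t : ℕ) (ht : 2 ≤ t) (hN : 2 * t < N) : GridCycle N (8 * t) :=
  (RectData.square t ht hN).gridCycle.cast (by rw [RectData.square_m]; ring)

end GridCycle

end Literature.Computability.QuantumComplexity
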